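import Mathlib
import Literature.Computability.Complexity.RangeAvoidance
import Literature.Computability.Complexity.SignDegreeXor
import Summits.PneNP.PneNP.Theorems.PstarIsolation
import Summits.PneNP.PneNP.Theorems.PstarIsolationBound
import Summits.PneNP.PneNP.Theorems.PstarIsolationRobust

/-!
# Isolation of the all-ones range point of a pure `P⋆` local map — quantitative form, the empty punctured
# ball, and base-point freedom

FRONTIER range-avoidance ladder, rung F-N3(ψ) (cell `pnp-ideate`, ROUND-19, mechanism M19; restricted-model
algorithmics — nothing here bears on `P` vs `NP`).  This file records the corollaries (a) and (c) of ROUND-19 §2, on top of `PstarIsolation` (K1), `PstarIsolationBound` (K2,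
promise `PseudoRandom`) and `PstarIsolationRobust` (K2⁺, promise `PseudoRandomW`):

* quantitative core: under `PseudoRandom (1/50) 2` with `m ≥ 900 n`, EVERY vertex set `U` flips at least
  `(13/50·C − 6√C)·|U| ≥ 54·|U|` outputs (`flipped_card_ge`, `le_flipped_card`); under `PseudoRandomW (1/50) 2 2`
  with `m ≥ 1600 n` the two regime bounds (`flipped_card_ge_W_small`, `flipped_card_ge_W_large`) and
  `2 ≤ |Ψ(U)|` for non-empty `U` (`two_le_flipped_card_W`);
* (a) `1ⁿ` is the UNIQUE preimage of `1ᵐ` (`eq_ones_of_eval_eq_ones`, `…W`) and the punctured Hamming ball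
  `{y ≠ 1ᵐ : #zeros(y) < 13C/50 − 6√C}` contains no range point (`zeros_card_ge_of_mem_range`,
  `not_mem_range_of_zeros_lt`; `W`: at least two zeros);
* (c) BASE-POINT FREEDOM: for a base point `x⋆` equal to `1` on every AND slot (`AndSaturated`) the set of outputs
  flipped by `x⋆ ⊕ 1_U` relative to `C(x⋆)` is the same set `Ψ(U)` (`flippedAt_eq_flipped`, a 64-pattern check),
  so every Hamming neighbour of `C(x⋆)` is outside the range, with the same constants, under either promise
  (`isolatedAt_of_pseudoRandom`, `isolatedAt_of_pseudoRandomW`); at `x⋆ = 1ⁿ` this is `AllOnesIsolated`;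
* the per-vertex (degree) form of the two promises is in `PstarIsolationDegrees`.
-/

set_option linter.dupNamespace false

open Finset Literature.Computability.Complexity
open Summit.PneNP.PneNP.Theorems.PstarIsolation
open Summit.PneNP.PneNP.Theorems.PstarIsolationBound (AllOnesIsolated PseudoRandom flip_bound)
open Summit.PneNP.PneNP.Theorems.PstarIsolationRobust (PseudoRandomW flipInequalityA)

namespace Summit.PneNP.PneNP.Theorems.PstarIsolationBase

variable {n m : ℕ}

/-! ## The quantitative core: every vertex set flips many outputs -/

/-- Under `PseudoRandom (1/50) 2`: `(13/50·C − 6·√C)·|U| ≤ |Ψ(U)|` for every vertex set `U` (`C = m/n`). -/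
theorem flipped_card_ge (I : LocalMap 4 n m) (hI : I.IsPure xorAndPred) (hR : PseudoRandom (1 / 50) 2 I)
    (U : Finset (Fin n)) :
    (13 / 50 * ((m : ℝ) / n) - 6 * Real.sqrt ((m : ℝ) / n)) * U.card ≤ ((flipped I U).card : ℝ) := by
  have hb := flip_bound I hI hR U
  linarith

/-- Under `PseudoRandom (1/50) 2` and `m ≥ 900 n`: every non-empty vertex set flips at least `54` outputs. -/
theorem le_flipped_card (I : LocalMap 4 n m) (hI : I.IsPure xorAndPred) (hR : PseudoRandom (1 / 50) 2 I)
    (hn : 0 < n) (hm : 900 * n ≤ m) (U : Finset (Fin n)) (hU : U.Nonempty) : 54 ≤ (flipped I U).card := by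
  have hu : (1 : ℝ) ≤ U.card := by exact_mod_cast hU.card_pos
  have hn' : (0 : ℝ) < n := by exact_mod_cast hn
  have hC : (900 : ℝ) ≤ (m : ℝ) / n := by
    rw [le_div_iff₀ hn']; exact_mod_cast hm
  set s : ℝ := Real.sqrt ((m : ℝ) / n) with hs
  have hs_sq : s ^ 2 = (m : ℝ) / n := Real.sq_sqrt (by positivity)
  have hs30 : 30 ≤ s := by
    have h9 : Real.sqrt 900 = 30 := by
      rw [show (900 : ℝ) = 30 ^ 2 by norm_num]; exact Real.sqrt_sq (by norm_num)
    rw [← h9]; exact Real.sqrt_le_sqrt hC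
  have hb := flipped_card_ge I hI hR U
  have hpos : (54 : ℝ) ≤ 13 / 50 * ((m : ℝ) / n) - 6 * s := by
    rw [← hs_sq]
    nlinarith [mul_nonneg (sub_nonneg.2 hs30) (by positivity : (0 : ℝ) ≤ 13 / 50 * s + 9 / 5)]
  have hmono : (13 / 50 * ((m : ℝ) / n) - 6 * s) * 1 ≤ (13 / 50 * ((m : ℝ) / n) - 6 * s) * U.card :=
    mul_le_mul_of_nonneg_left hu (by linarith)
  have h54 : (54 : ℝ) ≤ ((flipped I U).card : ℝ) := by linarith
  exact_mod_cast h54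

/-- Under `PseudoRandomW (1/50) 2 2`, small sets (`10|U| ≤ 3n`): `(31/50·C − 14·√C)·|U| ≤ |Ψ(U)|`
(bound (A) `PstarIsolationRobust.flipInequalityA`; the quadratic terms are at most `(3/10)·C·|U|`). -/
theorem flipped_card_ge_W_small (I : LocalMap 4 n m) (hI : I.IsPure xorAndPred)
    (hR : PseudoRandomW (1 / 50) 2 2 I) (hn : 0 < n) (U : Finset (Fin n)) (hreg : 10 * (U.card : ℝ) ≤ 3 * n) :
    (31 / 50 * ((m : ℝ) / n) - 14 * Real.sqrt ((m : ℝ) / n)) * U.card ≤ ((flipped I U).card : ℝ) := by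
  have hn' : (0 : ℝ) < n := by exact_mod_cast hn
  obtain ⟨hocc, -, -, heLhi, heA, heLA⟩ := hR U
  have hA : volL I U + volA I U ≤ (flipped I U).card + 2 * eL I U + eA I U + 2 * eLA I U :=
    flipInequalityA I hI U
  have hA' : (volL I U : ℝ) + volA I U ≤
      ((flipped I U).card : ℝ) + 2 * (eL I U : ℝ) + eA I U + 2 * (eLA I U : ℝ) := by exact_mod_cast hA
  have hQ : (m : ℝ) / n ^ 2 * (U.card : ℝ) ^ 2 ≤ 3 / 10 * ((m : ℝ) / n) * U.card := by
    have h1 : (m : ℝ) / n ^ 2 * (U.card : ℝ) ^ 2 = ((m : ℝ) / n * U.card) * ((U.card : ℝ) / n) := by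
      field_simp
    have h2 : (U.card : ℝ) / n ≤ 3 / 10 := by
      rw [div_le_iff₀ hn']; linarith
    have h3 : (0 : ℝ) ≤ (m : ℝ) / n * U.card := by positivity
    rw [h1]
    calc (m : ℝ) / n * U.card * ((U.card : ℝ) / n) ≤ (m : ℝ) / n * U.card * (3 / 10) :=
          mul_le_mul_of_nonneg_left h2 h3
      _ = 3 / 10 * ((m : ℝ) / n) * U.card := by ring
  linarith [hocc, heLhi, heA, heLA, hA', hQ]

/-- Under `PseudoRandomW (1/50) 2 2`, large sets (`3n < 10|U|`): `(49/25·C − 218/3·√C)·|U| ≤ 6·|Ψ(U)|`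
(the flip inequality K1; the global imbalance is at most `(20/3)·√C·|U|`). -/
theorem flipped_card_ge_W_large (I : LocalMap 4 n m) (hI : I.IsPure xorAndPred)
    (hR : PseudoRandomW (1 / 50) 2 2 I) (U : Finset (Fin n)) (hreg : 3 * (n : ℝ) < 10 * U.card) :
    (49 / 25 * ((m : ℝ) / n) - 218 / 3 * Real.sqrt ((m : ℝ) / n)) * U.card ≤ 6 * ((flipped I U).card : ℝ) := by
  set s : ℝ := Real.sqrt ((m : ℝ) / n) with hs
  have hs0 : 0 ≤ s := Real.sqrt_nonneg _
  obtain ⟨hocc, himb, heLlo, -, heA, heLA⟩ := hR U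
  have hK : (6 * volA I U + 10 * eL I U : ℕ) ≤ 6 * (flipped I U).card + 6 * eA I U + 5 * volL I U + eLA I U :=
    flipInequality n m I hI U
  have hK' : 6 * (volA I U : ℝ) + 10 * (eL I U : ℝ) ≤
      6 * ((flipped I U).card : ℝ) + 6 * (eA I U : ℝ) + 5 * (volL I U : ℝ) + (eLA I U : ℝ) := by
    exact_mod_cast hK
  have hsn : (3 * n) * s ≤ (10 * U.card) * s := mul_le_mul_of_nonneg_right hreg.le hs0
  linarith [hocc, himb, heLlo, heA, heLA, hK', hsn]

/-- Under `PseudoRandomW (1/50) 2 2` and `m ≥ 1600 n`: every non-empty vertex set flips at least two outputs. -/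
theorem two_le_flipped_card_W (I : LocalMap 4 n m) (hI : I.IsPure xorAndPred)
    (hR : PseudoRandomW (1 / 50) 2 2 I) (hn : 0 < n) (hm : 1600 * n ≤ m) (U : Finset (Fin n))
    (hU : U.Nonempty) : 2 ≤ (flipped I U).card := by
  have hu : (1 : ℝ) ≤ U.card := by exact_mod_cast hU.card_pos
  have hn' : (0 : ℝ) < n := by exact_mod_cast hn
  have hC : (1600 : ℝ) ≤ (m : ℝ) / n := by
    rw [le_div_iff₀ hn']; exact_mod_cast hm
  set s : ℝ := Real.sqrt ((m : ℝ) / n) with hs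
  have hs_sq : s ^ 2 = (m : ℝ) / n := Real.sq_sqrt (by positivity)
  have hs0 : 0 ≤ s := Real.sqrt_nonneg _
  have hs40 : 40 ≤ s := by
    have h16 : Real.sqrt 1600 = 40 := by
      rw [show (1600 : ℝ) = 40 ^ 2 by norm_num]; exact Real.sqrt_sq (by norm_num)
    rw [← h16]; exact Real.sqrt_le_sqrt hC
  have hss : 40 * s ≤ s ^ 2 := by rw [sq]; exact mul_le_mul_of_nonneg_right hs40 hs0
  suffices h : (2 : ℝ) ≤ ((flipped I U).card : ℝ) by exact_mod_cast h
  by_cases hreg : 10 * (U.card : ℝ) ≤ 3 * n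
  · have hb := flipped_card_ge_W_small I hI hR hn U hreg
    have hpos : (2 : ℝ) ≤ 31 / 50 * ((m : ℝ) / n) - 14 * s := by
      rw [← hs_sq]; linarith [hss, hs40]
    have hmono : (31 / 50 * ((m : ℝ) / n) - 14 * s) * 1 ≤ (31 / 50 * ((m : ℝ) / n) - 14 * s) * U.card :=
      mul_le_mul_of_nonneg_left hu (by linarith)
    linarith
  · have hlt : 3 * (n : ℝ) < 10 * U.card := by linarith
    have hb := flipped_card_ge_W_large I hI hR U hlt
    have hpos : (12 : ℝ) ≤ 49 / 25 * ((m : ℝ) / n) - 218 / 3 * s := by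
      rw [← hs_sq]; linarith [hss, hs40]
    have hmono : (49 / 25 * ((m : ℝ) / n) - 218 / 3 * s) * 1 ≤
        (49 / 25 * ((m : ℝ) / n) - 218 / 3 * s) * U.card :=
      mul_le_mul_of_nonneg_left hu (by linarith)
    linarith

/-! ## (a) Uniqueness of the preimage of `1ᵐ` and the empty punctured ball -/

/-- The zero set of an output string. -/
def zeros (y : Fin m → Bool) : Finset (Fin m) := univ.filter fun j => y j = false

/-- `Ψ(zero set of x)` is the zero set of `C(x)`. -/
theorem flipped_zeroSet (I : LocalMap 4 n m) (x : Fin n → Bool) :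
    flipped I (univ.filter fun v => x v = false) = zeros (I.eval x) := by
  unfold flipped zeros
  rw [gauge_zeroSet]

/-- An input other than `1ⁿ` has a non-empty zero set. -/
theorem zeroSet_nonempty (x : Fin n → Bool) (hx : x ≠ fun _ => true) :
    (univ.filter fun v => x v = false).Nonempty := by
  by_contra hU
  rw [Finset.not_nonempty_iff_eq_empty] at hU
  apply hx
  funext v
  by_contra hv
  have : v ∈ (univ.filter fun v => x v = false) := by
    simp only [Finset.mem_filter, Finset.mem_univ, true_and]
    simpa using hv
  rw [hU] at this
  simp at this

/-- An output string other than `1ᵐ` has a zero. -/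
theorem zeros_nonempty (y : Fin m → Bool) (hy : y ≠ fun _ => true) : (zeros y).Nonempty :=
  zeroSet_nonempty y hy

/-- **(a), quantitative.** Under `PseudoRandom (1/50) 2` and `m ≥ 900 n`, a range point other than `1ᵐ` has at
least `13C/50 − 6√C` (and at least `54`) zeros: the punctured Hamming ball of that radius around `1ᵐ = C(1ⁿ)`
contains no range point. -/
theorem zeros_card_ge_of_mem_range (I : LocalMap 4 n m) (hI : I.IsPure xorAndPred)
    (hR : PseudoRandom (1 / 50) 2 I) (hn : 0 < n) (hm : 900 * n ≤ m) (y : Fin m → Bool) (hy : y ∈ I.range)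
    (hy1 : y ≠ fun _ => true) :
    54 ≤ (zeros y).card ∧
      13 / 50 * ((m : ℝ) / n) - 6 * Real.sqrt ((m : ℝ) / n) ≤ ((zeros y).card : ℝ) := by
  obtain ⟨x, rfl⟩ := hy
  have hx : x ≠ fun _ => true := by
    rintro rfl
    exact hy1 (eval_ones I hI)
  have hU := zeroSet_nonempty x hx
  have h54 := le_flipped_card I hI hR hn hm _ hU
  have hb := flipped_card_ge I hI hR (univ.filter fun v => x v = false)
  rw [flipped_zeroSet] at h54 hb
  refine ⟨h54, ?_⟩
  have hu : (1 : ℝ) ≤ (univ.filter fun v => x v = false).card := by exact_mod_cast hU.card_pos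
  have h54' : (54 : ℝ) ≤ ((zeros (I.eval x)).card : ℝ) := by exact_mod_cast h54
  by_cases hc : 0 ≤ 13 / 50 * ((m : ℝ) / n) - 6 * Real.sqrt ((m : ℝ) / n)
  · have hmono := mul_le_mul_of_nonneg_left hu hc
    linarith
  · linarith

/-- **(a), avoidance form.** Under `PseudoRandom (1/50) 2` and `m ≥ 900 n`, every string `y ≠ 1ᵐ` with fewer than
`13C/50 − 6√C` zeros is outside the range. -/
theorem not_mem_range_of_zeros_lt (I : LocalMap 4 n m) (hI : I.IsPure xorAndPred)
    (hR : PseudoRandom (1 / 50) 2 I) (hn : 0 < n) (hm : 900 * n ≤ m) (y : Fin m → Bool)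
    (hy1 : y ≠ fun _ => true)
    (hfew : ((zeros y).card : ℝ) < 13 / 50 * ((m : ℝ) / n) - 6 * Real.sqrt ((m : ℝ) / n)) :
    y ∉ I.range := fun hy =>
  absurd (zeros_card_ge_of_mem_range I hI hR hn hm y hy hy1).2 (not_le.2 hfew)

/-- **(a), uniqueness.** Under `PseudoRandom (1/50) 2` and `m ≥ 900 n`, `1ⁿ` is the only preimage of `1ᵐ`. -/
theorem eq_ones_of_eval_eq_ones (I : LocalMap 4 n m) (hI : I.IsPure xorAndPred)
    (hR : PseudoRandom (1 / 50) 2 I) (hn : 0 < n) (hm : 900 * n ≤ m) (x : Fin n → Bool)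
    (hx : I.eval x = fun _ => true) : x = fun _ => true := by
  by_contra hne
  have h54 := le_flipped_card I hI hR hn hm _ (zeroSet_nonempty x hne)
  rw [flipped_zeroSet, hx] at h54
  have h0 : zeros (fun _ : Fin m => true) = ∅ := by
    ext j; simp [zeros]
  rw [h0, Finset.card_empty] at h54
  omega

/-- **(a) under the robust promise.** Under `PseudoRandomW (1/50) 2 2` and `m ≥ 1600 n`, a range point other
than `1ᵐ` has at least two zeros (no range point at Hamming distance `1` from `1ᵐ`). -/
theorem two_le_zeros_card_of_mem_range_W (I : LocalMap 4 n m) (hI : I.IsPure xorAndPred)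
    (hR : PseudoRandomW (1 / 50) 2 2 I) (hn : 0 < n) (hm : 1600 * n ≤ m) (y : Fin m → Bool)
    (hy : y ∈ I.range) (hy1 : y ≠ fun _ => true) : 2 ≤ (zeros y).card := by
  obtain ⟨x, rfl⟩ := hy
  have hx : x ≠ fun _ => true := by
    rintro rfl
    exact hy1 (eval_ones I hI)
  have h2 := two_le_flipped_card_W I hI hR hn hm _ (zeroSet_nonempty x hx)
  rwa [flipped_zeroSet] at h2

/-- **(a), uniqueness, robust promise.** Under `PseudoRandomW (1/50) 2 2` and `m ≥ 1600 n`, `1ⁿ` is the only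
preimage of `1ᵐ`. -/
theorem eq_ones_of_eval_eq_ones_W (I : LocalMap 4 n m) (hI : I.IsPure xorAndPred)
    (hR : PseudoRandomW (1 / 50) 2 2 I) (hn : 0 < n) (hm : 1600 * n ≤ m) (x : Fin n → Bool)
    (hx : I.eval x = fun _ => true) : x = fun _ => true := by
  by_contra hne
  have h2 := two_le_flipped_card_W I hI hR hn hm _ (zeroSet_nonempty x hne)
  rw [flipped_zeroSet, hx] at h2
  have h0 : zeros (fun _ : Fin m => true) = ∅ := by
    ext j; simp [zeros]
  rw [h0, Finset.card_empty] at h2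
  omega

/-! ## (c) Base-point freedom: any input saturating the AND slots is a fully sensitive base point -/

/-- The input `x⋆ ⊕ 1_U`. -/
def gaugeAt (xs : Fin n → Bool) (U : Finset (Fin n)) : Fin n → Bool :=
  fun v => if v ∈ U then !xs v else xs v

/-- The outputs whose value at `x⋆ ⊕ 1_U` differs from the value at `x⋆`. -/
def flippedAt (I : LocalMap 4 n m) (xs : Fin n → Bool) (U : Finset (Fin n)) : Finset (Fin m) :=
  univ.filter fun j => I.eval (gaugeAt xs U) j ≠ I.eval xs j

/-- A base point `x⋆` is AND-SATURATED if it equals `1` on every AND slot of every output. -/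
def AndSaturated (I : LocalMap 4 n m) (xs : Fin n → Bool) : Prop :=
  ∀ j, xs (I.vars j 2) = true ∧ xs (I.vars j 3) = true

/-- `C(x⋆) ⊕ e_i`. -/
def flipOut (y : Fin m → Bool) (i : Fin m) : Fin m → Bool := Function.update y i (!y i)

/-- At `x⋆ = 1ⁿ` the gauge is the one of `PstarIsolation`. -/
theorem gaugeAt_ones (U : Finset (Fin n)) : gaugeAt (fun _ => true) U = gauge U := by
  funext v
  by_cases h : v ∈ U <;> simp [gaugeAt, PstarIsolation.gauge, h]

/-- `1ⁿ` is AND-saturated. -/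
theorem andSaturated_ones (I : LocalMap 4 n m) : AndSaturated I fun _ => true := fun _ => ⟨rfl, rfl⟩

/-- `C(1ⁿ) ⊕ e_i = 1ᵐ ⊕ e_i`. -/
theorem flipOut_eval_ones (I : LocalMap 4 n m) (hI : I.IsPure xorAndPred) (i : Fin m) :
    flipOut (I.eval fun _ => true) i = onesFlip i := by
  rw [eval_ones I hI]; rfl

/-- **The 64-pattern check**: for an AND-saturated base point, output `j` is flipped by `x⋆ ⊕ 1_U` (relative to
`C(x⋆)`) iff it is flipped by `1 − 1_U` (relative to `1ᵐ`) — both happen iff `[tL_j = 1] ⊕ [tA_j ≥ 1]`. -/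
theorem mem_flippedAt_iff (I : LocalMap 4 n m) (hI : I.IsPure xorAndPred) (xs : Fin n → Bool)
    (hxs : AndSaturated I xs) (U : Finset (Fin n)) (j : Fin m) : j ∈ flippedAt I xs U ↔ j ∈ flipped I U := by
  simp only [flippedAt, flipped, Finset.mem_filter, Finset.mem_univ, true_and]
  rw [eval_gauge I hI U j]
  simp only [LocalMap.eval, hI.1 j, xorAndPred_apply, gaugeAt]
  obtain ⟨hc, hd⟩ := hxs j
  rcases Bool.dichotomy (xs (I.vars j 0)) with ha | ha <;>
  rcases Bool.dichotomy (xs (I.vars j 1)) with hb | hb <;>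
  by_cases h0 : I.vars j 0 ∈ U <;> by_cases h1 : I.vars j 1 ∈ U <;> by_cases h2 : I.vars j 2 ∈ U <;>
    by_cases h3 : I.vars j 3 ∈ U <;> simp [ha, hb, hc, hd, h0, h1, h2, h3]

/-- For an AND-saturated base point, `x⋆ ⊕ 1_U` flips (relative to `C(x⋆)`) exactly the set `Ψ(U)`. -/
theorem flippedAt_eq_flipped (I : LocalMap 4 n m) (hI : I.IsPure xorAndPred) (xs : Fin n → Bool)
    (hxs : AndSaturated I xs) (U : Finset (Fin n)) : flippedAt I xs U = flipped I U := by
  ext j; exact mem_flippedAt_iff I hI xs hxs U j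

/-- A preimage `x` of `C(x⋆) ⊕ e_i` is `x⋆ ⊕ 1_U` for a NON-EMPTY `U` with `|Ψ(U)| = 1` (when `x⋆` is
AND-saturated). -/
theorem exists_flipped_card_eq_one (I : LocalMap 4 n m) (hI : I.IsPure xorAndPred) (xs : Fin n → Bool)
    (hxs : AndSaturated I xs) (i : Fin m) (x : Fin n → Bool) (hx : I.eval x = flipOut (I.eval xs) i) :
    ∃ U : Finset (Fin n), U.Nonempty ∧ (flipped I U).card = 1 := by
  set U : Finset (Fin n) := univ.filter fun v => x v ≠ xs v with hU
  have hxg : gaugeAt xs U = x := by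
    funext v
    by_cases h : x v = xs v
    · have hv : v ∉ U := by simp [hU, h]
      simp only [gaugeAt, hv, if_false, h]
    · have hv : v ∈ U := by simp [hU, h]
      simp only [gaugeAt, hv, if_true]
      revert h
      rcases Bool.dichotomy (x v) with h1 | h1 <;> rcases Bool.dichotomy (xs v) with h2 | h2 <;> simp [h1, h2]
  refine ⟨U, ?_, ?_⟩
  · by_contra hne
    rw [Finset.not_nonempty_iff_eq_empty] at hne
    have hxx : x = xs := by
      funext v
      by_contra hv
      have : v ∈ U := by simp [hU, hv]
      rw [hne] at this
      simp at this
    have := congrFun hx i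
    rw [hxx, flipOut, Function.update_self] at this
    revert this
    rcases Bool.dichotomy (I.eval xs i) with h1 | h1 <;> simp [h1]
  · rw [← flippedAt_eq_flipped I hI xs hxs U, Finset.card_eq_one]
    refine ⟨i, ?_⟩
    ext j
    simp only [flippedAt, Finset.mem_filter, Finset.mem_univ, true_and, Finset.mem_singleton, hxg, hx, flipOut]
    by_cases hj : j = i
    · subst hj
      rw [Function.update_self]
      rcases Bool.dichotomy (I.eval xs j) with h1 | h1 <;> simp [h1]
    · rw [Function.update_of_ne hj]
      simp [hj]

/-- **(c) Base-point freedom.** Under `PseudoRandom (1/50) 2` and `m ≥ 900 n`, every Hamming neighbour of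
`C(x⋆)` is outside the range, for EVERY AND-saturated base point `x⋆` (a whole affine family of certified
non-range points when some variables never occur in AND slots). -/
theorem isolatedAt_of_pseudoRandom (I : LocalMap 4 n m) (hI : I.IsPure xorAndPred)
    (hR : PseudoRandom (1 / 50) 2 I) (hn : 0 < n) (hm : 900 * n ≤ m) (xs : Fin n → Bool)
    (hxs : AndSaturated I xs) (i : Fin m) : flipOut (I.eval xs) i ∉ I.range := by
  rintro ⟨x, hx⟩
  obtain ⟨U, hU, hcard⟩ := exists_flipped_card_eq_one I hI xs hxs i x hx
  have h54 := le_flipped_card I hI hR hn hm U hU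
  omega

/-- **(c) Base-point freedom, robust promise.** Under `PseudoRandomW (1/50) 2 2` and `m ≥ 1600 n`, every Hamming
neighbour of `C(x⋆)` is outside the range, for every AND-saturated base point `x⋆`. -/
theorem isolatedAt_of_pseudoRandomW (I : LocalMap 4 n m) (hI : I.IsPure xorAndPred)
    (hR : PseudoRandomW (1 / 50) 2 2 I) (hn : 0 < n) (hm : 1600 * n ≤ m) (xs : Fin n → Bool)
    (hxs : AndSaturated I xs) (i : Fin m) : flipOut (I.eval xs) i ∉ I.range := by
  rintro ⟨x, hx⟩
  obtain ⟨U, hU, hcard⟩ := exists_flipped_card_eq_one I hI xs hxs i x hx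
  have h2 := two_le_flipped_card_W I hI hR hn hm U hU
  omega

/-- Sanity: at the base point `1ⁿ`, base-point isolation is `AllOnesIsolated`. -/
theorem allOnesIsolated_of_isolatedAt (I : LocalMap 4 n m) (hI : I.IsPure xorAndPred)
    (h : ∀ i : Fin m, flipOut (I.eval fun _ => true) i ∉ I.range) : AllOnesIsolated I := fun i => by
  rw [← flipOut_eval_ones I hI i]; exact h i

end Summit.PneNP.PneNP.Theorems.PstarIsolationBase
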